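import Summits.QuantumFields.YangMills.Theorems.AllWindowsColdBoxBoxHighLineCubicCutBetaSharp
import Summits.QuantumFields.YangMills.Theorems.AllWindowsColdBoxBoxHighLineTiltSupBoundsCubicCut
import Summits.QuantumFields.YangMills.Theorems.AllWindowsColdBoxBoxHighLineGaussianNormalFormOnCutSet
import Summits.QuantumFields.YangMills.Theorems.AllWindowsColdBoxBoxHighLineTiltCovZeroMainCutSet
import Summits.QuantumFields.YangMills.Theorems.AllWindowsColdBoxBoxHighLineAssemblyEpsTwoThird
import Summits.QuantumFields.YangMills.Theorems.AllWindowsColdBoxBoxHighLineEdgeChartParity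

/-!
# The CUT small field of record `D′ = smallField s ∖ E_cubic`, by name (ASSEMBLY-U5 v0.4 §3 (D′), ruling «D versus D′» 2026-08-30)
# (LINE-20 U5 ⟨stmt-QuantumFields-24336⟩; U5 prep, helper-grade glue; U5 OPEN)

Width seat `ym-line-sfw-p2-w4` (prover-ym-line-sfw-p2-w4-g29-0).  The third-order assembly works on the cut small field
`D′ = smallField H s ∖ E`, `E = {1 + C₅βH⁴s⁵ ≤ |cubicVertex β H ·|}`, `s = β^{−1/2+κ₃}`.  This file packages, in the letters the
glue files consume, the four facts about `D′` the assembler needs, with ONE constant `C₅` and ONE threshold `β₀`: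

* `neg_mem_cubicCut_iff`, ★`neg_mem_cutSet_iff` — `E` and `D′` are symmetric under `a ↦ −a` (the cubic vertex is odd,
  ✓`EdgeChartGaussian.cubicVertex_neg`): the `hsym` hypothesis of the parity lemmas of ✓`RestrictionSetSlots`;
  `measurableSet_cutSet`, `cutSet_subset_smallField`, `mem_cutSet_iff`;
* `setIntegral_smallField_half_diff_le` + ★★`exists_beta0_cubicCut_sharp'` — the sharp cut ✓`SmallFieldFPSharp.exists_beta0_cubicCut_sharp`
  (fixed moment order, (K4) `κ₃ + 4θ < 1/2`) in the SAME-RADIUS shape, token for token the conclusion of the (N2) fallback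
  ✓`SmallFieldFP.exists_beta0_cubicCut` = the `hcut` of ✓`GaussNormalForm.abs_chartCov_sub_tiltCov_muCut_one_le` with `τ = β^{−q}`;
* ★`exists_beta0_gaussAvg_one_sub_indicator_cutSet_le` — the Gaussian co-mass `τ″ = E₀[1 − 1_{D′}] ≤ β^{−q}/2` for `β ≥ β₀`
  (✓`GaussRestrict.gaussAvg_one_sub_indicator_cutSet_le` in β-letters: shift row ✓`AssemblyBudget.shift_budget`, exponential row
  ✓`ErrorBudget.exists_forall_natPow_exp_le`, polynomial row at the fixed order `r = ⌈(q+1)/(1−4θ)⌉₊ + 1`; window `4θ < 1 ∧ 4θ + 5κ₃ < 3/2`),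
  hence `1/2 ≤ E₀[1_{D′}]` (✓`GaussRestrict.half_le_gaussAvg_indicator`) — the mass hypothesis of the `μ_{D′}` lemmas / κ₅′;
* ★★ **`exists_cutSet_record`** — ONE `C₅ ≥ 0`, ONE `β₀ ≥ 1`: for `β ≥ β₀`, `1 ≤ H ≤ β^θ + 1`: (i) `sup_{D′}|tiltU| ≤ 2`
  (✓`TiltSup.exists_forall_abs_tiltU_le_on_cubicCut`), (ii) the cut at `τ = β^{−q}` in the same-radius shape and (iii) in the half-radius shape,
  (iv) `τ″ ≤ β^{−q}/2` and `1/2 ≤ E₀[1_{D′}]`; hypotheses `0 < θ`, `0 < κ₃`, (K4) `κ₃ + 4θ < 1/2`, `4θ + 4κ₃ < 1`, `6θ + 2κ₃ < 1`, `0 ≤ q`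
  (all hold at the exponent point of record ✓`BoxToChart.exists_exponents_third`, `κ₃ = 1/8 − θ/4`, every `θ < 1/10`).

Everything proved; no definitions; standard axioms.  HONEST LABEL: U5 prep, helper-grade glue; U5 ⟨24336⟩, ⟨24004⟩ and the seat's own crux
⟨22884⟩ remain OPEN; no stub is closed by name, no crux, rung or summit is proved; **the Yang–Mills mass gap is NOT proved by this file; no summit
is proved by a line.**
-/

set_option autoImplicit false

open MeasureTheory Real Finset

namespace Summit.QuantumFields.YangMills.Theorems.AllWindowsColdBoxBoxHighLine

namespace CutSetRecord

open SmallFieldFP SmallFieldFPSharp TiltSup EdgeChartGaussian GaussRestrict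

variable {H : ℕ}

/-! ## Symmetry, measurability, membership -/

/-- The cubic event `{t ≤ |V₃|}` is symmetric under `a ↦ −a` (the cubic vertex is odd). -/
theorem neg_mem_cubicCut_iff (β t : ℝ) (a : LandauFree H → E3) :
    -a ∈ {a : LandauFree H → E3 | t ≤ |cubicVertex β H a|} ↔ a ∈ {a : LandauFree H → E3 | t ≤ |cubicVertex β H a|} := by
  simp only [Set.mem_setOf_eq, cubicVertex_neg, abs_neg]

/-- ★ The cut small field `D′ = smallField H s ∖ {t ≤ |V₃|}` is symmetric under `a ↦ −a`
(the `hsym` hypothesis of the parity lemmas of ✓`RestrictionSetSlots`). -/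
theorem neg_mem_cutSet_iff (β t s : ℝ) (a : LandauFree H → E3) :
    -a ∈ smallField H s \ {a : LandauFree H → E3 | t ≤ |cubicVertex β H a|} ↔
      a ∈ smallField H s \ {a : LandauFree H → E3 | t ≤ |cubicVertex β H a|} := by
  rw [Set.mem_sdiff, Set.mem_sdiff, neg_mem_smallField_iff, neg_mem_cubicCut_iff]

/-- The cut small field is measurable. -/
theorem measurableSet_cutSet (β C₅ s lam : ℝ) :
    MeasurableSet (smallField H s \ {a : LandauFree H → E3 | lam + C₅ * β * (H : ℝ) ^ 4 * s ^ 5 ≤ |cubicVertex β H a|}) :=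
  (ChartGauss.measurableSet_smallField s).diff (measurableSet_cubicCut β C₅ s lam)

/-- The cut small field lies in the small field. -/
theorem cutSet_subset_smallField (β t s : ℝ) :
    smallField H s \ {a : LandauFree H → E3 | t ≤ |cubicVertex β H a|} ⊆ smallField H s :=
  Set.sdiff_subset

/-- Membership in the cut small field: `a ∈ D′ ↔ a ∈ smallField H s ∧ |V₃ a| < t`. -/
theorem mem_cutSet_iff (β t s : ℝ) (a : LandauFree H → E3) :
    a ∈ smallField H s \ {a : LandauFree H → E3 | t ≤ |cubicVertex β H a|} ↔ a ∈ smallField H s ∧ |cubicVertex β H a| < t := by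
  rw [Set.mem_sdiff, Set.mem_setOf_eq, not_le]

/-! ## The sharp cut in the same-radius shape -/

/-- Shrinking the reference radius: `∫_{smallField (s/2) ∖ A} w_J ≤ ∫_{smallField s ∖ A} w_J` (`0 ≤ β`, `0 ≤ s`). -/
theorem setIntegral_smallField_half_diff_le {β s : ℝ} (hβ : 0 ≤ β) (hs : 0 ≤ s) (r : ℝ) (A : Set (LandauFree H → E3)) :
    ∫ a in smallField H (s / 2) \ A, fpChartWeight β H r a ≤ ∫ a in smallField H s \ A, fpChartWeight β H r a := by
  have hsub : smallField H (s / 2) \ A ⊆ smallField H s \ A := by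
    intro a ha
    exact ⟨fun e => (ha.1 e).trans (by linarith), ha.2⟩
  exact setIntegral_mono_set
    ((GaussNormalForm.integrableOn_fpChartWeight_smallField' (H := H) hβ hs r).mono_set Set.sdiff_subset)
    (ae_of_all _ fun a => FPChart.fpChartWeight_nonneg β r a) (ae_of_all _ hsub)

/-- ★★ **The sharp cut, same-radius shape** (token for token the conclusion of ✓`SmallFieldFP.exists_beta0_cubicCut`, under (K4) alone):
for `0 < θ`, `0 < κ₃`, `κ₃ + 4θ < 1/2`, `0 ≤ q` there are `C₅ ≥ 0`, `β₀ ≥ 1` with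
`∫_{smallField s ∩ E} w_J ≤ β^{−q}·∫_{smallField s ∖ E} w_J` for `β ≥ β₀`, `1 ≤ H ≤ β^θ + 1`, `r ≥ s = β^{−1/2+κ₃}`. -/
theorem exists_beta0_cubicCut_sharp' {θ κ₃ q : ℝ} (hθ : 0 < θ) (hκ0 : 0 < κ₃) (hK4 : κ₃ + 4 * θ < 1 / 2) (hq : 0 ≤ q) :
    ∃ C₅ β₀ : ℝ, 0 ≤ C₅ ∧ 1 ≤ β₀ ∧ ∀ β : ℝ, β₀ ≤ β → ∀ H : ℕ, 1 ≤ H → (H : ℝ) ≤ β ^ θ + 1 → ∀ r : ℝ, β ^ (-1 / 2 + κ₃) ≤ r →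
      ∫ a in smallField H (β ^ (-1 / 2 + κ₃)) ∩
          {a | 1 + C₅ * β * (H : ℝ) ^ 4 * (β ^ (-1 / 2 + κ₃)) ^ 5 ≤ |cubicVertex β H a|}, fpChartWeight β H r a ≤
        β ^ (-q) * ∫ a in smallField H (β ^ (-1 / 2 + κ₃)) \
          {a | 1 + C₅ * β * (H : ℝ) ^ 4 * (β ^ (-1 / 2 + κ₃)) ^ 5 ≤ |cubicVertex β H a|}, fpChartWeight β H r a := by
  obtain ⟨C₅, β₀, hC₅, hβ₀, h⟩ := exists_beta0_cubicCut_sharp (q := q) hθ hκ0 hK4 hq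
  refine ⟨C₅, β₀, hC₅, hβ₀, fun β hβ H hH hHβ r hr => (h β hβ H hH hHβ r hr).trans ?_⟩
  have hβpos : 0 < β := by linarith
  exact mul_le_mul_of_nonneg_left (setIntegral_smallField_half_diff_le hβpos.le (Real.rpow_nonneg hβpos.le _) r _)
    (Real.rpow_nonneg hβpos.le _)

/-! ## The Gaussian co-mass of the cut small field in β-letters -/

/-- `β·(β^{−1/2+κ})⁵`-free bookkeeping: `c·β·(β^{−1/2+κ})² = c·β^{2κ}`. -/
theorem mul_beta_mul_rpow_sq {β κ : ℝ} (hβ : 0 < β) (c : ℝ) : c * β * (β ^ (-1 / 2 + κ)) ^ 2 = c * β ^ (2 * κ) := by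
  rw [mul_assoc, beta_mul_rpow_sq hβ]

/-- The polynomial row at a fixed order: `4^r·(2r−1)^{3r}·(C·H⁴·L³/β)^r = (4^r·(2r−1)^{3r}·C^r·H^{4r}·L^{3r}·β^{q−r})·β^{−q}` (`β > 0`). -/
theorem polyRow_eq {C L β q : ℝ} {H : ℕ} (hβ : 0 < β) (r : ℕ) :
    (4 : ℝ) ^ r * ((2 * r - 1 : ℝ) ^ (r * 3) * (C * (H : ℝ) ^ 4 * L ^ 3 / β) ^ r) =
      (4 : ℝ) ^ r * (2 * r - 1 : ℝ) ^ (r * 3) * C ^ r * (H : ℝ) ^ (4 * r) * L ^ (3 * r) * β ^ (q - r) * β ^ (-q) := by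
  rw [AssemblyBudget.cubicTail_pow_eq hβ r]
  have e : β ^ (q - (r : ℝ)) * β ^ (-q) = β ^ (-(r : ℝ)) := by
    rw [← Real.rpow_add hβ]; ring_nf
  calc (4 : ℝ) ^ r * ((2 * r - 1 : ℝ) ^ (r * 3) * (C ^ r * (H : ℝ) ^ (4 * r) * L ^ (3 * r) * β ^ (-(r : ℝ))))
      = (4 : ℝ) ^ r * (2 * r - 1 : ℝ) ^ (r * 3) * C ^ r * (H : ℝ) ^ (4 * r) * L ^ (3 * r) * (β ^ (q - (r : ℝ)) * β ^ (-q)) := by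
        rw [e]; ring
    _ = _ := by ring

/-- ★ **The co-mass of the cut small field, β-letters**: for `0 < θ`, `4θ < 1`, `0 < κ₃`, `4θ + 5κ₃ < 3/2`, real `q`, `C₅ ≥ 0` there is
`β₀ ≥ 1` with `E₀[1 − 1_{D′}] ≤ β^{−q}/2` for `β ≥ β₀`, `1 ≤ H ≤ β^θ + 1` (`D′ = smallField s ∖ {1 + C₅βH⁴s⁵ ≤ |V₃|}`, `s = β^{−1/2+κ₃}`). -/
theorem exists_beta0_gaussAvg_one_sub_indicator_cutSet_le {θ κ₃ : ℝ} (hθ : 0 < θ) (h4θ : 4 * θ < 1) (hκ0 : 0 < κ₃)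
    (h5 : 4 * θ + 5 * κ₃ < 3 / 2) (q : ℝ) {C₅ : ℝ} (hC₅ : 0 ≤ C₅) :
    ∃ β₀ : ℝ, 1 ≤ β₀ ∧ ∀ β : ℝ, β₀ ≤ β → ∀ H : ℕ, 1 ≤ H → (H : ℝ) ≤ β ^ θ + 1 →
      gaussAvg β H (fun a => 1 - (smallField H (β ^ (-1 / 2 + κ₃)) \
          {a | 1 + C₅ * β * (H : ℝ) ^ 4 * (β ^ (-1 / 2 + κ₃)) ^ 5 ≤ |cubicVertex β H a|}).indicator (fun _ => (1 : ℝ)) a) ≤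
        β ^ (-q) / 2 := by
  obtain ⟨C₆, c, C, hc, -, hτ⟩ := gaussAvg_one_sub_indicator_cutSet_le
  have hθ0 : 0 ≤ θ := hθ.le
  have h14 : 0 < 1 - 4 * θ := by linarith
  -- the fixed polynomial order
  set r : ℕ := ⌈(q + 1) / (1 - 4 * θ)⌉₊ + 1 with hr
  have hr1 : 1 ≤ r := by rw [hr]; omega
  have hrq : ((4 * r : ℕ) : ℝ) * θ + (q - r) < ((0 : ℕ) : ℝ) * (1 / 2 - κ₃) := by
    have h1 : (q + 1) / (1 - 4 * θ) ≤ (⌈(q + 1) / (1 - 4 * θ)⌉₊ : ℝ) := Nat.le_ceil _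
    have h2 : (r : ℝ) = (⌈(q + 1) / (1 - 4 * θ)⌉₊ : ℝ) + 1 := by rw [hr]; push_cast; ring
    have h3 : q + 1 ≤ (⌈(q + 1) / (1 - 4 * θ)⌉₊ : ℝ) * (1 - 4 * θ) := by rwa [div_le_iff₀ h14] at h1
    push_cast
    nlinarith
  -- thresholds: shift row, exponential row, polynomial row
  obtain ⟨b₀, hb₀1, hb₀⟩ := AssemblyBudget.shift_budget hθ0 h5 C
  obtain ⟨b₁, hb₁1, hb₁⟩ := ErrorBudget.exists_forall_natPow_exp_le (γ := 2 * κ₃) hθ0 (by linarith) hc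
    (by norm_num : (0 : ℝ) < 1 / 4) C₆ q 4
  obtain ⟨b₂, hb₂1, hb₂⟩ := AssemblyBudget.budget_monomial (κ₃ := κ₃) hθ0 hrq (by norm_num : (0 : ℝ) < 1 / 4)
    ((4 : ℝ) ^ r * (2 * r - 1 : ℝ) ^ (r * 3) * C ^ r) (3 * r)
  refine ⟨max b₀ (max b₁ b₂), le_max_of_le_left hb₀1, fun β hβ H hH hHβ => ?_⟩
  have hβ0 : b₀ ≤ β := (le_max_left _ _).trans hβ
  have hβ1 : b₁ ≤ β := ((le_max_left _ _).trans (le_max_right _ _)).trans hβ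
  have hβ2 : b₂ ≤ β := ((le_max_right _ _).trans (le_max_right _ _)).trans hβ
  have hβone : 1 ≤ β := hb₀1.trans hβ0
  have hβpos : 0 < β := by linarith
  set s : ℝ := β ^ (-1 / 2 + κ₃) with hs
  have hspos : 0 < s := Real.rpow_pos_of_pos hβpos _
  -- the shift premise
  have hshift : C * β * (H : ℝ) ^ 4 * s ^ 5 ≤ 1 / 2 := by
    have h := hb₀ β hβ0 H hH hHβ
    rwa [show (κ₃ - 1 / 2 : ℝ) = -1 / 2 + κ₃ by ring] at h
  have hmain := hτ H hH β s hβpos hspos hshift C₅ hC₅ r hr1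
  -- exponential row
  have hexp : C₆ * (H : ℝ) ^ 4 * Real.exp (-(c * β * s ^ 2)) ≤ 1 / 4 * β ^ (-q) := by
    have h := hb₁ β hβ1 H hH hHβ
    have hβq : 0 < β ^ q := Real.rpow_pos_of_pos hβpos _
    have e1 : c * β * s ^ 2 = c * β ^ (2 * κ₃) := by rw [hs, mul_beta_mul_rpow_sq hβpos]
    have e2 : β ^ (-q) = 1 / β ^ q := by rw [Real.rpow_neg hβpos.le, one_div]
    rw [e1, e2, mul_one_div, le_div_iff₀ hβq]
    calc C₆ * (H : ℝ) ^ 4 * Real.exp (-(c * β ^ (2 * κ₃))) * β ^ q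
        = C₆ * (H : ℝ) ^ 4 * β ^ q * Real.exp (-(c * β ^ (2 * κ₃))) := by ring
      _ ≤ 1 / 4 := h
  -- polynomial row
  have hpoly : (4 : ℝ) ^ r * ((2 * r - 1 : ℝ) ^ (r * 3) * (C * (H : ℝ) ^ 4 * (1 + Real.log H) ^ 3 / β) ^ r) ≤ 1 / 4 * β ^ (-q) := by
    have h := hb₂ β hβ2 H hH hHβ
    rw [pow_zero, mul_one] at h
    rw [polyRow_eq (q := q) hβpos r]
    exact mul_le_mul_of_nonneg_right h (Real.rpow_nonneg hβpos.le _)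
  calc gaussAvg β H (fun a => 1 - (smallField H s \
          {a | 1 + C₅ * β * (H : ℝ) ^ 4 * s ^ 5 ≤ |cubicVertex β H a|}).indicator (fun _ => (1 : ℝ)) a)
      ≤ C₆ * (H : ℝ) ^ 4 * Real.exp (-(c * β * s ^ 2)) +
          (4 : ℝ) ^ r * ((2 * r - 1 : ℝ) ^ (r * 3) * (C * (H : ℝ) ^ 4 * (1 + Real.log H) ^ 3 / β) ^ r) := hmain
    _ ≤ 1 / 4 * β ^ (-q) + 1 / 4 * β ^ (-q) := add_le_add hexp hpoly
    _ = β ^ (-q) / 2 := by ring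

/-- ★ **Mass of the cut small field**: under the same window, `E₀[1 − 1_{D′}] ≤ 1/2` and `1/2 ≤ E₀[1_{D′}]` for `β ≥ β₀`, `1 ≤ H ≤ β^θ + 1`
(the mass hypothesis of the `μ_{D′}` lemmas of ✓`RestrictionSetMoments`/✓`RestrictionSetSlots`). -/
theorem exists_beta0_half_le_gaussAvg_cutSet {θ κ₃ : ℝ} (hθ : 0 < θ) (h4θ : 4 * θ < 1) (hκ0 : 0 < κ₃) (h5 : 4 * θ + 5 * κ₃ < 3 / 2)
    {C₅ : ℝ} (hC₅ : 0 ≤ C₅) :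
    ∃ β₀ : ℝ, 1 ≤ β₀ ∧ ∀ β : ℝ, β₀ ≤ β → ∀ H : ℕ, 1 ≤ H → (H : ℝ) ≤ β ^ θ + 1 →
      gaussAvg β H (fun a => 1 - (smallField H (β ^ (-1 / 2 + κ₃)) \
          {a | 1 + C₅ * β * (H : ℝ) ^ 4 * (β ^ (-1 / 2 + κ₃)) ^ 5 ≤ |cubicVertex β H a|}).indicator (fun _ => (1 : ℝ)) a) ≤ 1 / 2 ∧
      1 / 2 ≤ gaussAvg β H ((smallField H (β ^ (-1 / 2 + κ₃)) \
          {a | 1 + C₅ * β * (H : ℝ) ^ 4 * (β ^ (-1 / 2 + κ₃)) ^ 5 ≤ |cubicVertex β H a|}).indicator fun _ => (1 : ℝ)) := by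
  obtain ⟨β₀, hβ₀, h⟩ := exists_beta0_gaussAvg_one_sub_indicator_cutSet_le hθ h4θ hκ0 h5 0 hC₅
  refine ⟨β₀, hβ₀, fun β hβ H hH hHβ => ?_⟩
  have hβpos : 0 < β := by linarith
  have h1 := h β hβ H hH hHβ
  rw [neg_zero, Real.rpow_zero] at h1
  have h1' : gaussAvg β H (fun a => 1 - (smallField H (β ^ (-1 / 2 + κ₃)) \
      {a | 1 + C₅ * β * (H : ℝ) ^ 4 * (β ^ (-1 / 2 + κ₃)) ^ 5 ≤ |cubicVertex β H a|}).indicator (fun _ => (1 : ℝ)) a) ≤ 1 / 2 := by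
    linarith
  exact ⟨h1', half_le_gaussAvg_indicator hβpos (measurableSet_cutSet β C₅ _ 1) h1' le_rfl⟩

/-! ## The record -/

/-- ★★ **CUT-SET INSTANCE OF RECORD** (ASSEMBLY-U5 §3 (D′)).  For `0 < θ`, `0 < κ₃`, (K4) `κ₃ + 4θ < 1/2`, `4θ + 4κ₃ < 1`, `6θ + 2κ₃ < 1`
and `0 ≤ q` there are ONE constant `C₅ ≥ 0` and ONE threshold `β₀ ≥ 1` such that for every `β ≥ β₀` and `1 ≤ H ≤ β^θ + 1`, with
`s = β^{−1/2+κ₃}`, `E = {1 + C₅βH⁴s⁵ ≤ |cubicVertex β H ·|}`, `D′ = smallField H s ∖ E`: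
(i) `|tiltU β H a| ≤ 2` for every `a ∈ D′`;
(ii) `∫_{smallField s ∩ E} w_J ≤ β^{−q}·∫_{D′} w_J` for every `r ≥ s` (`w_J = fpChartWeight β H r`);
(iii) the same with the half-radius reference set `smallField (s/2) ∖ E`;
(iv) `E₀[1 − 1_{D′}] ≤ β^{−q}/2`, `E₀[1 − 1_{D′}] ≤ 1/2` and `1/2 ≤ E₀[1_{D′}]`. -/
theorem exists_cutSet_record {θ κ₃ q : ℝ} (hθ : 0 < θ) (hκ0 : 0 < κ₃) (hK4 : κ₃ + 4 * θ < 1 / 2) (h4 : 4 * θ + 4 * κ₃ < 1)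
    (h6 : 6 * θ + 2 * κ₃ < 1) (hq : 0 ≤ q) :
    ∃ C₅ β₀ : ℝ, 0 ≤ C₅ ∧ 1 ≤ β₀ ∧ ∀ β : ℝ, β₀ ≤ β → ∀ H : ℕ, 1 ≤ H → (H : ℝ) ≤ β ^ θ + 1 →
      (∀ a ∈ smallField H (β ^ (-1 / 2 + κ₃)) \
          {a | 1 + C₅ * β * (H : ℝ) ^ 4 * (β ^ (-1 / 2 + κ₃)) ^ 5 ≤ |cubicVertex β H a|}, |tiltU β H a| ≤ 2) ∧
      (∀ r : ℝ, β ^ (-1 / 2 + κ₃) ≤ r →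
        ∫ a in smallField H (β ^ (-1 / 2 + κ₃)) ∩
            {a | 1 + C₅ * β * (H : ℝ) ^ 4 * (β ^ (-1 / 2 + κ₃)) ^ 5 ≤ |cubicVertex β H a|}, fpChartWeight β H r a ≤
          β ^ (-q) * ∫ a in smallField H (β ^ (-1 / 2 + κ₃)) \
            {a | 1 + C₅ * β * (H : ℝ) ^ 4 * (β ^ (-1 / 2 + κ₃)) ^ 5 ≤ |cubicVertex β H a|}, fpChartWeight β H r a) ∧
      (∀ r : ℝ, β ^ (-1 / 2 + κ₃) ≤ r →
        ∫ a in smallField H (β ^ (-1 / 2 + κ₃)) ∩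
            {a | 1 + C₅ * β * (H : ℝ) ^ 4 * (β ^ (-1 / 2 + κ₃)) ^ 5 ≤ |cubicVertex β H a|}, fpChartWeight β H r a ≤
          β ^ (-q) * ∫ a in smallField H (β ^ (-1 / 2 + κ₃) / 2) \
            {a | 1 + C₅ * β * (H : ℝ) ^ 4 * (β ^ (-1 / 2 + κ₃)) ^ 5 ≤ |cubicVertex β H a|}, fpChartWeight β H r a) ∧
      gaussAvg β H (fun a => 1 - (smallField H (β ^ (-1 / 2 + κ₃)) \
          {a | 1 + C₅ * β * (H : ℝ) ^ 4 * (β ^ (-1 / 2 + κ₃)) ^ 5 ≤ |cubicVertex β H a|}).indicator (fun _ => (1 : ℝ)) a) ≤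
        β ^ (-q) / 2 ∧
      gaussAvg β H (fun a => 1 - (smallField H (β ^ (-1 / 2 + κ₃)) \
          {a | 1 + C₅ * β * (H : ℝ) ^ 4 * (β ^ (-1 / 2 + κ₃)) ^ 5 ≤ |cubicVertex β H a|}).indicator (fun _ => (1 : ℝ)) a) ≤ 1 / 2 ∧
      1 / 2 ≤ gaussAvg β H ((smallField H (β ^ (-1 / 2 + κ₃)) \
          {a | 1 + C₅ * β * (H : ℝ) ^ 4 * (β ^ (-1 / 2 + κ₃)) ^ 5 ≤ |cubicVertex β H a|}).indicator fun _ => (1 : ℝ)) := by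
  have h4θ : 4 * θ < 1 := by linarith
  have h5 : 4 * θ + 5 * κ₃ < 3 / 2 := by linarith
  obtain ⟨C₅, b₀, hC₅, hb₀1, hcut⟩ := exists_beta0_cubicCut_sharp (q := q) hθ hκ0 hK4 hq
  obtain ⟨b₁, hb₁1, hsup⟩ := exists_forall_abs_tiltU_le_on_cubicCut (ε := 1) hθ h4 h6 hC₅ 1 one_pos
  obtain ⟨b₂, hb₂1, hco⟩ := exists_beta0_gaussAvg_one_sub_indicator_cutSet_le hθ h4θ hκ0 h5 q hC₅
  obtain ⟨b₃, hb₃1, hmass⟩ := exists_beta0_half_le_gaussAvg_cutSet hθ h4θ hκ0 h5 hC₅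
  refine ⟨C₅, max (max b₀ b₁) (max b₂ b₃), hC₅, le_max_of_le_left (le_max_of_le_left hb₀1), fun β hβ H hH hHβ => ?_⟩
  have hβ0 : b₀ ≤ β := ((le_max_left _ _).trans (le_max_left _ _)).trans hβ
  have hβ1 : b₁ ≤ β := ((le_max_right _ _).trans (le_max_left _ _)).trans hβ
  have hβ2 : b₂ ≤ β := ((le_max_left _ _).trans (le_max_right _ _)).trans hβ
  have hβ3 : b₃ ≤ β := ((le_max_right _ _).trans (le_max_right _ _)).trans hβ
  have hβpos : 0 < β := by linarith
  refine ⟨fun a ha => ?_, fun r hr => ?_, hcut β hβ0 H hH hHβ, hco β hβ2 H hH hHβ, hmass β hβ3 H hH hHβ⟩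
  · rw [mem_cutSet_iff] at ha
    have := hsup β hβ1 H hH hHβ a ha.1 ha.2
    linarith
  · exact (hcut β hβ0 H hH hHβ r hr).trans (mul_le_mul_of_nonneg_left
      (setIntegral_smallField_half_diff_le hβpos.le (Real.rpow_nonneg hβpos.le _) r _) (Real.rpow_nonneg hβpos.le _))

end CutSetRecord

end Summit.QuantumFields.YangMills.Theorems.AllWindowsColdBoxBoxHighLine
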